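import Summits.BirchSwinnertonDyer.BirchSwinnertonDyer.Theorems.SmallImageMuTransferMuTransferX9LocalExponentBadPrimesUniform
import Summits.BirchSwinnertonDyer.BirchSwinnertonDyer.Theorems.SmallImageMuTransferMuTransferX9ShiftEmbedUnramified
import Literature.NumberTheory.GaloisRepresentations.ContinuousCohomologyConnecting
import HarnessLib

/-!
# K6 crux `MuTransferX9` (stmt-BirchSwinnertonDyer-19276), stub `stub_selmerDualOdd` (skeleton v6),
# local lemma (L-p), target (Lp-3) LOCAL MULTI-STEP EMBED KERNEL: a local class of `𝒯_J` killed by the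
# `T^{L−J}`-embedding into `𝒯_L` is killed by `T^{d·p^m}` (`#M ≤ p^d`, `m` = the depth at `v`)

Cell `bsd-smallim`, seat `bsd-smallim-k6-lur-b` (gen 0).  HONEST FRAMING: theorems only (no definition, no
named fact, no `sorry`); nothing is asserted about any curve and nothing is booked.  Helper toward the
registered stub `stub_selmerDualOdd` of skeleton v6 (sha16 a90a661b046bb403) of crux 19276 — target (Lp-3)
of k6-c2's (L-p) architecture (STATUS 2026-08-26 17:30Z, plan g10 RULING 18:58Z), the LAST step of (L-p):
from `loc_p(T^{2+b} Y) = 0` to `loc_p(T^{εp} Ψ) = 0` through `embed Ψ = T^k Y`; closes nothing.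
Generic: any number field `K`, any finite discrete `p`-torsion `ρ` on `M`, any `ℤ_p`-extension `κ`,
ANY finite place `v` (in particular `v ∣ p`).

MATHEMATICS.  Let `𝒯_J = κ.twistModP ρ hM J`, restricted to `Γ_{K_v}` (`GaloisRep.toLocal v`), and let
`g ∈ Γ_{K_v}` be `ρ`-trivial of depth `m` (`ρ(res g) = 1`, `res g ∈ Γ_m ∖ Γ_{m+1}`).
* `isSES_localShiftEmbed_localTruncate`: `0 → 𝒯_J →(T^{L−J}·) 𝒯_L →(first L−J coordinates) 𝒯_{L−J} → 0`
  is a short exact sequence of discrete `Γ_{K_v}`-modules (pattern of k6-c2's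
  `IwasawaTwistModPTowerExact.isSES_shiftEmbed_constCoeff`, multi-step, local).
* Long exact sequence (tree `IsSES.exists_δ₀_eq_of_map_one_eq_zero`): the kernel of
  `H¹(K_v, 𝒯_J) → H¹(K_v, 𝒯_L)` lies in `δ₀(H⁰(K_v, 𝒯_{L−J}))`, so it is finite of order
  `≤ #H⁰(K_v, 𝒯_{L−J}) ≤ #M^{p^m}` (k6-g4 `natCard_invariants_toLocal_twistModP_le_of_depth`, valid at
  EVERY place: the invariants lie in the fixed points `𝒯[T^{p^m}]` of `g`):
  `natCard_ker_localShiftEmbed_le_of_depth`.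
* The kernel is stable under the local shift `T_v = H¹(K_v, S)` (`S` commutes with the embedding,
  `shiftEnd_shiftEmbed`), on which `T_v` is nilpotent (`T_v^J = 0`, k6-g4 `localShift_iterate_eq_zero_of_le`)
  and which is killed by `p`; a nilpotent endomorphism of an `𝔽_p`-space of order `≤ p^{d·p^m}` has
  `T^{d·p^m} = 0` (k6-g4 `iterate_eq_zero_of_nilpotent_of_natCard_le`):
  `localShift_iterate_eq_zero_of_map_localShiftEmbed_eq_zero`.
* Global form, k6-c2's requested signature VERBATIM:
  **`localization_shiftH1_iterate_eq_zero_of_localization_map_shiftEmbed_eq_zero`** — if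
  `loc_v (H¹(T^{L−J}-embed) c) = 0` then `loc_v (T^[d·p^m] c) = 0` (`loc_v` commutes with `H¹` of
  equivariant maps, `galoisCohomology.res_map_one`).

PARTITION (D-0054): X9 (A4) × p ∈ {5,7} (+ X10b∧¬Surj at 3) — helper toward `stub_selmerDualOdd`; closes none.

References: J.-P. Serre, *Galois Cohomology* (1997) I §2.2 (long exact sequence), I §2.4
[SerreGaloisCohomology1997]; B. Mazur, K. Rubin, Mem. AMS 799 (2004) §5.3, Lemma 5.3.1 [MazurRubin2004];
L. Washington, *Introduction to Cyclotomic Fields* §13.1–13.2 [Washington1997];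
HOME/koly/MU-TRANSFER-PROOF.md (F6), §5 STEP 1.
-/

set_option linter.dupNamespace false
set_option autoImplicit false

noncomputable section

open scoped NumberField ContRepresentation
open CategoryTheory Function Field IsDedekindDomain NumberField
open Literature.NumberTheory.GaloisRepresentations
open Literature.NumberTheory.EllipticCurves
open Summit.BirchSwinnertonDyer.BirchSwinnertonDyer.Rank1Residual.LocalSplitPrime
  (iterate_eq_zero_of_nilpotent_of_natCard_le natCard_invariants_toLocal_twistModP_le_of_depth
    localShift_iterate_eq_zero_of_le)

universe u

namespace Summit.BirchSwinnertonDyer.BirchSwinnertonDyer.Rank1Residual.SelmerDual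

/-! ## §0 Two pieces of bookkeeping for `H¹` of a discrete Galois module -/

section Bookkeeping

variable {F : Type u} [Field F] {M N : Type u} [AddCommGroup M] [TopologicalSpace M] [DiscreteTopology M]
  [AddCommGroup N] [TopologicalSpace N] [DiscreteTopology N]
  {ρ : DiscreteGaloisModule F M} {ρ' : DiscreteGaloisModule F N}

/-- `galoisCohomology.map f 1` IS the tree's `cohomologyMap` of the attached morphism of topological
representations (both are Mathlib's `ContinuousCohomology.map` along the identity; checked on classes).
[cite: SerreGaloisCohomology1997, I §2.2] -/
theorem galoisCohomology_map_one_eq_cohomologyMap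
    (f : ρ.toContRepresentation →ⁱL ρ'.toContRepresentation) (c : galoisCohomology ρ 1) :
    galoisCohomology.map f 1 c =
      cohomologyMap (TopRep.ofHom ⟨f.toContinuousLinearMap, f.isIntertwining'⟩ :
        ρ.toTopRep ⟶ ρ'.toTopRep) 1 c := by
  obtain ⟨φ, rfl⟩ := oneCocycleClass_surjective _ c
  rw [galoisCohomology.map_one_oneCocycleClass, cohomologyMap_oneCocycleClass]
  rfl

/-- Two intertwining squares with pointwise-commuting underlying maps induce commuting maps on `H¹`:
if `f' (e x) = e' (f x)` for all `x` then `H¹(f') (H¹(e) c) = H¹(e') (H¹(f) c)`.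
[cite: SerreGaloisCohomology1997, I §2.2] -/
theorem galoisCohomology_map_map_comm {P Q : Type u} [AddCommGroup P] [TopologicalSpace P]
    [DiscreteTopology P] [AddCommGroup Q] [TopologicalSpace Q] [DiscreteTopology Q]
    {σ : DiscreteGaloisModule F P} {τ : DiscreteGaloisModule F Q}
    (e : ρ.toContRepresentation →ⁱL σ.toContRepresentation)
    (f : ρ.toContRepresentation →ⁱL ρ'.toContRepresentation)
    (f' : σ.toContRepresentation →ⁱL τ.toContRepresentation)
    (e' : ρ'.toContRepresentation →ⁱL τ.toContRepresentation)
    (hcomm : ∀ x : M, f' (e x) = e' (f x)) (c : galoisCohomology ρ 1) :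
    galoisCohomology.map f' 1 (galoisCohomology.map e 1 c) =
      galoisCohomology.map e' 1 (galoisCohomology.map f 1 c) := by
  obtain ⟨φ, rfl⟩ := oneCocycleClass_surjective _ c
  rw [galoisCohomology.map_one_oneCocycleClass, galoisCohomology.map_one_oneCocycleClass,
    galoisCohomology.map_one_oneCocycleClass, galoisCohomology.map_one_oneCocycleClass]
  exact congrArg _ (Subtype.ext (ContinuousMap.ext fun g => hcomm (φ.1 g)))

/-- **Kernel bookkeeping for a pair of commuting additive maps.**  Let `E : H → H'`, `T : H → H` be
additive with `E (T y) = 0` whenever `E y = 0` (the kernel of `E` is `T`-stable), `H` killed by the prime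
`p`, `T^[J] = 0`, and `ker E` finite of order `≤ p^N`.  Then `T^[N] x = 0` for every `x ∈ ker E`
(k6-g4's `iterate_eq_zero_of_nilpotent_of_natCard_le` on the `T`-stable subgroup `ker E`). [folklore] -/
theorem iterate_eq_zero_of_map_eq_zero_of_natCard_ker_le {H H' : Type*} [AddCommGroup H] [AddCommGroup H']
    {p : ℕ} [Fact p.Prime] (E : H →+ H') (T : H →+ H) (hstab : ∀ y, E y = 0 → E (T y) = 0)
    (hp : ∀ y : H, p • y = 0) {J : ℕ} (hnil : ∀ y, (⇑T)^[J] y = 0) [Finite E.ker] {N : ℕ}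
    (hcard : Nat.card E.ker ≤ p ^ N) (x : H) (hx : E x = 0) : (⇑T)^[N] x = 0 := by
  let TB : E.ker →+ E.ker :=
    (T.comp E.ker.subtype).codRestrict E.ker fun y => (AddMonoidHom.mem_ker).2 (hstab y.1 y.2)
  have hTB : ∀ (k : ℕ) (y : E.ker), ((⇑TB)^[k] y).1 = (⇑T)^[k] y.1 := by
    intro k
    induction k with
    | zero => intro y; rfl
    | succ k ih =>
      intro y
      rw [Function.iterate_succ_apply', Function.iterate_succ_apply', ← ih y]
      rfl
  have hpB : ∀ b : E.ker, p • b = 0 := fun b => Subtype.ext (hp b.1)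
  have hnilB : ∀ b : E.ker, (⇑TB)^[J] b = 0 := fun b => Subtype.ext ((hTB J b).trans (hnil b.1))
  have key := congrArg Subtype.val
    (iterate_eq_zero_of_nilpotent_of_natCard_le hpB TB hnilB hcard ⟨x, (AddMonoidHom.mem_ker).2 hx⟩)
  rw [hTB] at key
  exact key

end Bookkeeping

/-! ## §1 The local short exact sequence `0 → 𝒯_J →(T^{L−J}·) 𝒯_L → 𝒯_{L−J} → 0` over `Γ_{K_v}` -/

section LocalSES

variable {K : Type u} [Field K] [NumberField K] {M : Type u} [AddCommGroup M] [TopologicalSpace M]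
  [DiscreteTopology M] (ρ : DiscreteGaloisModule K M) {p : ℕ} [Fact p.Prime]
  (hM : ∀ x : M, p • x = 0) (κ : ZpExtension K p) (v : HeightOneSpectrum (𝓞 K)) {J L : ℕ} (h : J ≤ L)

/-- **`0 → 𝒯_J →(T^{L−J}·) 𝒯_L →(first L−J coordinates) 𝒯_{L−J} → 0` is a short exact sequence of
discrete `Γ_{K_v}`-modules** (multi-step and local form of k6-c2's `isSES_shiftEmbed_constCoeff`):
`x ↦ T^{L−J}x` is injective with image the vectors whose first `L − J` coordinates vanish, and
truncation is onto. [cite: Washington1997, §13.1–§13.2] [cite: SerreGaloisCohomology1997, I §2.2] -/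
theorem isSES_localShiftEmbed_localTruncate :
    IsSES
      (TopRep.ofHom ⟨((κ.twistModPShiftEmbed ρ hM L h).restrictField (v.adicCompletion K)).toContinuousLinearMap,
          ((κ.twistModPShiftEmbed ρ hM L h).restrictField (v.adicCompletion K)).isIntertwining'⟩ :
        (GaloisRep.toLocal v (κ.twistModP ρ hM J)).toTopRep ⟶ (GaloisRep.toLocal v (κ.twistModP ρ hM L)).toTopRep)
      (TopRep.ofHom ⟨((κ.twistModPTruncate ρ hM L (Nat.sub_le L J)).restrictField
            (v.adicCompletion K)).toContinuousLinearMap,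
          ((κ.twistModPTruncate ρ hM L (Nat.sub_le L J)).restrictField (v.adicCompletion K)).isIntertwining'⟩ :
        (GaloisRep.toLocal v (κ.twistModP ρ hM L)).toTopRep ⟶
          (GaloisRep.toLocal v (κ.twistModP ρ hM (L - J))).toTopRep) where
  comp_eq_zero := by
    ext x i
    change ZpExtension.shiftEmbed L h x (Fin.castLE (Nat.sub_le L J) i) = 0
    rw [ZpExtension.shiftEmbed_apply, dif_neg]
    simp only [Fin.val_castLE, not_le]
    exact i.2
  injective := SelmerDualUnramified.shiftEmbed_injective L h
  exact_mid := by
    intro y hy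
    refine ⟨fun i => y ⟨(i : ℕ) + (L - J), by omega⟩, funext fun i => ?_⟩
    change ZpExtension.shiftEmbed L h (fun i : Fin J => y ⟨(i : ℕ) + (L - J), by omega⟩) i = y i
    rw [ZpExtension.shiftEmbed_apply]
    by_cases hi : L - J ≤ (i : ℕ)
    · rw [dif_pos hi]
      congr 1
      exact Fin.ext (by simp only; omega)
    · rw [dif_neg hi]
      have h0 := congrFun hy ⟨(i : ℕ), by omega⟩
      change y (Fin.castLE (Nat.sub_le L J) ⟨(i : ℕ), _⟩) = 0 at h0
      have hci : Fin.castLE (Nat.sub_le L J) ⟨(i : ℕ), by omega⟩ = i := Fin.ext rfl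
      rw [hci] at h0
      exact h0.symm
  surjective := by
    intro z
    refine ⟨fun i => if hi : (i : ℕ) < L - J then z ⟨i, hi⟩ else 0, funext fun i => ?_⟩
    change (fun i : Fin L => if hi : (i : ℕ) < L - J then z ⟨i, hi⟩ else 0)
      (Fin.castLE (Nat.sub_le L J) i) = z i
    simp only [Fin.val_castLE, Fin.is_lt, ↓reduceDIte, Fin.eta]

end LocalSES

/-! ## §2 The kernel of `H¹(K_v, 𝒯_J) → H¹(K_v, 𝒯_L)` is small and `T^{d·p^m}` kills it -/

section Kernel

variable {K : Type u} [Field K] [NumberField K] {M : Type u} [AddCommGroup M] [TopologicalSpace M]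
  [DiscreteTopology M] [Finite M] (ρ : DiscreteGaloisModule K M) {p : ℕ} [Fact p.Prime]
  (hM : ∀ x : M, p • x = 0) (κ : ZpExtension K p) (v : HeightOneSpectrum (𝓞 K))

omit [Finite M] in
/-- **Every local class of `𝒯_J` killed by the `T^{L−J}`-embedding is a `δ₀`-image from
`H⁰(K_v, 𝒯_{L−J})`** (exactness of `H⁰(𝒯_{L−J}) →δ₀ H¹(𝒯_J) → H¹(𝒯_L)`).
[cite: SerreGaloisCohomology1997, I §2.2] -/
theorem exists_δ₀_eq_of_map_localShiftEmbed_eq_zero {J L : ℕ} (h : J ≤ L)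
    (x : galoisCohomology (GaloisRep.toLocal v (κ.twistModP ρ hM J)) 1)
    (hx : galoisCohomology.map ((κ.twistModPShiftEmbed ρ hM L h).restrictField (v.adicCompletion K)) 1 x = 0) :
    ∃ z : (GaloisRep.toLocal v (κ.twistModP ρ hM (L - J))).toTopRep.ρ.invariants,
      (isSES_localShiftEmbed_localTruncate ρ hM κ v h).δ₀ z = x := by
  refine (isSES_localShiftEmbed_localTruncate ρ hM κ v h).exists_δ₀_eq_of_map_one_eq_zero x ?_
  rw [← galoisCohomology_map_one_eq_cohomologyMap]
  exact hx

/-- **The kernel of `H¹(K_v, 𝒯_J) → H¹(K_v, 𝒯_L)` is FINITE of order `≤ #M^{p^m}`**, for any `ρ`-trivial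
`g ∈ Γ_{K_v}` of depth `m` in the `ℤ_p`-tower of `κ` (the kernel injects into `H⁰(K_v, 𝒯_{L−J})`, bounded by
k6-g4's `natCard_invariants_toLocal_twistModP_le_of_depth` at EVERY place).
[cite: MazurRubin2004, Lemma 5.3.1] [cite: SerreGaloisCohomology1997, I §2.2] -/
theorem finite_and_natCard_ker_localShiftEmbed_le_of_depth {J L : ℕ} (h : J ≤ L)
    {g : absoluteGaloisGroup (v.adicCompletion K)}
    (hg : ρ (absGaloisRestrict K (v.adicCompletion K) g) = 1) {m : ℕ}
    (hgm : absGaloisRestrict K (v.adicCompletion K) g ∈ κ.layerSubgroup m)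
    (hgm' : absGaloisRestrict K (v.adicCompletion K) g ∉ κ.layerSubgroup (m + 1)) :
    Finite (galoisCohomology.map ((κ.twistModPShiftEmbed ρ hM L h).restrictField (v.adicCompletion K)) 1).ker ∧
      Nat.card (galoisCohomology.map ((κ.twistModPShiftEmbed ρ hM L h).restrictField
        (v.adicCompletion K)) 1).ker ≤ Nat.card M ^ (p ^ m) := by
  set I := (GaloisRep.toLocal v (κ.twistModP ρ hM (L - J))).toTopRep.ρ.invariants with hI
  -- a section of `δ₀` on the kernel
  have hsec : ∀ x : (galoisCohomology.map ((κ.twistModPShiftEmbed ρ hM L h).restrictField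
      (v.adicCompletion K)) 1).ker, ∃ z : I, (isSES_localShiftEmbed_localTruncate ρ hM κ v h).δ₀ z = x.1 :=
    fun x => exists_δ₀_eq_of_map_localShiftEmbed_eq_zero ρ hM κ v h x.1 x.2
  choose s hs using hsec
  have hsinj : Function.Injective s := fun x y hxy => Subtype.ext (by rw [← hs x, ← hs y, hxy])
  haveI : Finite I := inferInstance
  exact ⟨Finite.of_injective s hsinj, (Nat.card_le_card_of_injective s hsinj).trans
    (natCard_invariants_toLocal_twistModP_le_of_depth ρ hM κ (L - J) v hg hgm hgm')⟩

omit [Finite M] in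
/-- The `T^{L−J}`-embedding commutes with the local shifts on `H¹`: `H¹(embed) (T_v x) = T_v (H¹(embed) x)`
(`S` commutes with `T^{L−J}·` on vectors, `shiftEnd_shiftEmbed`). [cite: Washington1997, §13.1–§13.2] -/
theorem map_localShiftEmbed_localShift {J L : ℕ} (h : J ≤ L)
    (x : galoisCohomology (GaloisRep.toLocal v (κ.twistModP ρ hM J)) 1) :
    galoisCohomology.map ((κ.twistModPShiftEmbed ρ hM L h).restrictField (v.adicCompletion K)) 1
        (galoisCohomology.map ((κ.twistModPShift ρ hM J).restrictField (v.adicCompletion K)) 1 x) =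
      galoisCohomology.map ((κ.twistModPShift ρ hM L).restrictField (v.adicCompletion K)) 1
        (galoisCohomology.map ((κ.twistModPShiftEmbed ρ hM L h).restrictField (v.adicCompletion K)) 1 x) :=
  galoisCohomology_map_map_comm _ _ _ _ (fun y => (ZpExtension.shiftEnd_shiftEmbed L h y).symm) x

/-- **(Lp-3), local form.**  Let `v` be ANY finite place, `g ∈ Γ_{K_v}` `ρ`-trivial of depth `m`,
`#M ≤ p^d`, `J ≤ L`.  A local class `x ∈ H¹(K_v, 𝒯_J)` killed by `H¹` of the `T^{L−J}`-embedding into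
`𝒯_L` is killed by `T_v^{d·p^m}` (`T_v = H¹(K_v, S)` the local shift): the kernel is a `T_v`-stable
`𝔽_p`-space of order `≤ #M^{p^m} ≤ p^{d·p^m}` on which `T_v` is nilpotent.
[cite: MazurRubin2004, Lemma 5.3.1] [cite: SerreGaloisCohomology1997, I §2.2] -/
theorem localShift_iterate_eq_zero_of_map_localShiftEmbed_eq_zero
    {g : absoluteGaloisGroup (v.adicCompletion K)}
    (hg : ρ (absGaloisRestrict K (v.adicCompletion K) g) = 1) {m : ℕ}
    (hgm : absGaloisRestrict K (v.adicCompletion K) g ∈ κ.layerSubgroup m)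
    (hgm' : absGaloisRestrict K (v.adicCompletion K) g ∉ κ.layerSubgroup (m + 1))
    {d : ℕ} (hd : Nat.card M ≤ p ^ d) {J L : ℕ} (h : J ≤ L)
    (x : galoisCohomology (GaloisRep.toLocal v (κ.twistModP ρ hM J)) 1)
    (hx : galoisCohomology.map ((κ.twistModPShiftEmbed ρ hM L h).restrictField (v.adicCompletion K)) 1 x = 0) :
    (galoisCohomology.map ((κ.twistModPShift ρ hM J).restrictField (v.adicCompletion K)) 1)^[d * p ^ m] x = 0 := by
  obtain ⟨hfin, hcard⟩ := finite_and_natCard_ker_localShiftEmbed_le_of_depth ρ hM κ v h hg hgm hgm'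
  haveI := hfin
  have hε : Nat.card (galoisCohomology.map ((κ.twistModPShiftEmbed ρ hM L h).restrictField
      (v.adicCompletion K)) 1).ker ≤ p ^ (d * p ^ m) := by
    rw [pow_mul]
    exact hcard.trans (Nat.pow_le_pow_left hd _)
  have hMJ : ∀ y : Fin J → M, p • y = 0 := fun y => funext fun i => hM (y i)
  refine iterate_eq_zero_of_map_eq_zero_of_natCard_ker_le
    (galoisCohomology.map ((κ.twistModPShiftEmbed ρ hM L h).restrictField (v.adicCompletion K)) 1)
    (galoisCohomology.map ((κ.twistModPShift ρ hM J).restrictField (v.adicCompletion K)) 1)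
    (fun y hy => ?_)
    (galoisCohomology.nsmul_eq_zero_of_forall (GaloisRep.toLocal v (κ.twistModP ρ hM J)) hMJ)
    (localShift_iterate_eq_zero_of_le ρ hM κ J v le_rfl) hε x hx
  rw [map_localShiftEmbed_localShift ρ hM κ v h y, hy]
  exact map_zero _

/-- **(Lp-3) LOCAL MULTI-STEP EMBED KERNEL (k6-c2's requested signature).**  For a GLOBAL class
`c ∈ H¹(K, 𝒯_J)` whose `T^{L−J}`-embedded image localises to `0` at `v`, the localisation at `v` of
`T^[d·p^m] c` vanishes (`loc_v` commutes with `H¹` of equivariant maps, `galoisCohomology.res_map_one`).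
This is the last step of (L-p): from `loc_p(T^{2+b} Y) = 0` to `loc_p(T^{εp} Ψ) = 0` via `embed Ψ = T^k Y`.
[cite: MazurRubin2004, Lemma 5.3.1] [cite: SerreGaloisCohomology1997, I §2.2 and I §2.4] -/
theorem localization_shiftH1_iterate_eq_zero_of_localization_map_shiftEmbed_eq_zero
    {g : absoluteGaloisGroup (v.adicCompletion K)}
    (hg : ρ (absGaloisRestrict K (v.adicCompletion K) g) = 1) {m : ℕ}
    (hgm : absGaloisRestrict K (v.adicCompletion K) g ∈ κ.layerSubgroup m)
    (hgm' : absGaloisRestrict K (v.adicCompletion K) g ∉ κ.layerSubgroup (m + 1))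
    {d : ℕ} (hd : Nat.card M ≤ p ^ d) {J L : ℕ} (h : J ≤ L)
    (c : galoisCohomology (κ.twistModP ρ hM J) 1)
    (hc : galoisCohomology.localization (κ.twistModP ρ hM L) (Sum.inr v) 1
      (galoisCohomology.map (κ.twistModPShiftEmbed ρ hM L h) 1 c) = 0) :
    galoisCohomology.localization (κ.twistModP ρ hM J) (Sum.inr v) 1
      ((κ.shiftH1 ρ hM J)^[d * p ^ m] c) = 0 := by
  -- localisation commutes with the shift (k6-g4's `hcomm`) and with the embedding
  have hcomm : ∀ (k : ℕ) (z : galoisCohomology (κ.twistModP ρ hM J) 1),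
      galoisCohomology.localization (κ.twistModP ρ hM J) (Sum.inr v) 1 ((κ.shiftH1 ρ hM J)^[k] z) =
        (galoisCohomology.map ((κ.twistModPShift ρ hM J).restrictField (v.adicCompletion K)) 1)^[k]
          (galoisCohomology.localization (κ.twistModP ρ hM J) (Sum.inr v) 1 z) := by
    intro k
    induction k with
    | zero => intro z; rfl
    | succ k ih =>
      intro z
      rw [Function.iterate_succ_apply', Function.iterate_succ_apply', ← ih]
      exact galoisCohomology.res_map_one (v.adicCompletion K) (κ.twistModPShift ρ hM J) _
  have hx : galoisCohomology.map ((κ.twistModPShiftEmbed ρ hM L h).restrictField (v.adicCompletion K)) 1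
      (galoisCohomology.localization (κ.twistModP ρ hM J) (Sum.inr v) 1 c) = 0 :=
    (galoisCohomology.res_map_one (v.adicCompletion K) (κ.twistModPShiftEmbed ρ hM L h) c).symm.trans hc
  rw [hcomm]
  exact localShift_iterate_eq_zero_of_map_localShiftEmbed_eq_zero ρ hM κ v hg hgm hgm' hd h _ hx

end Kernel

end Summit.BirchSwinnertonDyer.BirchSwinnertonDyer.Rank1Residual.SelmerDual

end
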